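import Summits.BirchSwinnertonDyer.Rank1Residual.O5.HeegnerLogTransportThreeStepZeroEndAnyDiscrIso
import Summits.BirchSwinnertonDyer.Rank1Residual.O5.HeegnerLogTransportThreeRatLogUnit
import Summits.BirchSwinnertonDyer.Rank1Residual.Additive.PadicLogFormalGroup
import Summits.BirchSwinnertonDyer.Rank1Residual.Supersingular.RationalLadder
import HarnessLib
import HarnessLib.Audit.Tags

/-!
# O5 KL3 part 24 — the unit-log binder `hQW` as a KERNEL CERTIFICATE: `ord_p log_ω(Q₀) = k − ord_p m` from a
# rational multiple `m • Q₀ = (x_R, y_R)` with `ord_p x_R = −2k` (odd `p`); ladder + `decide` front-end; the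
# `…_cited_s0f` / `…_cited_s0f_iso` ENDs with `hQW` DISCHARGED per row (cell `b2b-bsdres`, lane CLASS-CLOSURE,
# class O5 (t′); seat o5-r2 GEN 26)

HONEST FRAMING (cell `b2b-bsdres`, run/shared/lean/b2b/bsd-rank1-residual/, verbatim in every file): the goal
of the cell is to DELETE the COMBINATION-SHAPED residual classes of the Birch–Swinnerton-Dyer formula for ALL
analytic-rank `≤ 1` elliptic curves over `ℚ` — "full BSD formula for every rank `≤ 1` curve in class `C`"
assembled STRICTLY from published theorems — so that the rank-`≤ 1` remainder becomes exactly the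
CONSTRUCTION-SHAPED classes, which are TYPED (missing-input `Prop`s), NOT attempted. This is not "finishing
BSD". Lane CLASS-CLOSURE: research routes; no claim beyond the stated classes; nothing is booked here; no mark
of `RESIDUAL-MAP.md` moves; census numbers are EVIDENCE, never a Literature fact. THEOREMS plus ONE `Bool`
checker `def` (`logUnitOKQ`, the shape of the tree's `Supersingular.dblOKQ` / `addOKQ`); no named fact, no
conjecture node (net named-fact debt `0`); no node file is touched; O5 stays OPEN.

## What this file does

The KL3 ENDs of record (`o5_index_unit_of_ordinary_companion_cited_s0f`, p356092, and its ISO-currency form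
`…_cited_s0f_iso`, p357191) display the binder
`hQW : ∃ Q : (W.baseChange K).toAffine.Point, ¬ IsOfFinAddOrder Q ∧ X11b.padicLogOrd W 3 (embAt K 3 𝔭 h𝔭 he hf) Q = 0`,
so far fed only by the census column `dE = 0` (PARI `elllog`, an INSTRUMENT). Part 12 (`exists_logUnit_point_of_rat`,
p-tree `O5/HeegnerLogTransportThreeRatLogUnit.lean`) reduced it to a rational point `Q₀ ∈ W(ℚ)` of infinite order with
`ord_p (padicLog (W ⊗ ℚ_p) (Q₀ ⊗ ℚ_p)) = 0`. THIS file makes that datum a FINITE EXACT COMPUTATION checked by the kernel: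

* §1 `norm_padicFormalLog_sub_self_le_of_norm_le_half`, `norm_padicFormalLog_eq_of_norm_lt_half`,
  `norm_padicFormalLog_eq_of_norm_le_inv` — `‖log_W(t) − t‖ ≤ 2‖t‖²` for `‖t‖ ≤ 1/2`, hence `‖log_W(t)‖ = ‖t‖` for
  `‖t‖ < 1/2`, in particular on ALL of `pℤ_p` when `p` is ODD (the tree's `X11b.LocalIndex.norm_padicFormalLog_eq`
  needs `‖t‖ ≤ p⁻²`; at `p = 2`, `‖t‖ = 1/2` the statement is false in general). [AEC IV.6.3(a), IV.6.4(b)]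
* §2 `padicLog_eq_padicLogPoint_of_isInReductionKernel` — the cell's `ℤ_p`-linear logarithm `padicLog` IS
  `log_W ∘ z` on the whole kernel of reduction `E₁(ℚ_p)` (tree: on `E⁽²⁾(ℚ_p)`), and for odd `p`
  `‖padicLog X P‖ = ‖z(P)‖`, `ord_p (padicLog X P) = ord_p z(P)` there.
* §3 **`valuation_padicLog_of_nsmul_eq`** (KERNEL `dE` READOUT) — for a `p`-integral elliptic `X/ℚ_p`, `p` odd,
  `m • Q = R = (x_R, y_R)` with `ord_p x_R = −2k`, `k ≥ 1`: `padicLog X Q ≠ 0` (so `Q` has infinite order) and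
  `ord_p (padicLog X Q) = k − ord_p m` (`R ∈ E₁(ℚ_p)`, `‖y_R‖² = ‖x_R‖³` gives `ord_p z(R) = k`, and
  `log R = m · log Q`). The unit case `ord_p m = k`: `valuation_padicLog_eq_zero_of_nsmul_eq`.
* §4 `exists_logUnit_point_of_nsmul_eq` — for `W/ℚ` globally minimal and a RATIONAL multiple
  `m • Q₀ = (x_R, y_R) ∈ W(ℚ)` with `padicValRat p x_R = −2k`, `0 < k = padicValNat p m`: the END binder `hQW`
  holds in EVERY `W(K)` along EVERY `ι : K →+* ℚ_p` (part 12) — and `Q₀` is PROVED of infinite order (no `hQ₀`).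
* §5 `logUnitOKQ` + `logUnitOKQ_sound` + **`exists_logUnit_point_of_ladder`** — division-free front-end: a base
  point `(x₀, y₀) ∈ W(ℚ)`, a tree LADDER (`Supersingular.ladderRunQ`, `decide +kernel`) to
  `R = m • (x₀, y₀)`, `m = qScalar 1 steps`, and the check `0 < k ∧ p^k ∥ m ∧ p ∤ num, den (x_R · p^{2k})`
  (`decide +kernel`) give `hQW`. For the KL3 (t′) rows: `p = 3`, `m = m₀ = [W(ℚ₃) : W₁(ℚ₃)] = 3·c₃ = 6`
  (type III*, `c₃ = 2`), `k = 1` — two ladder steps.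
* §6 ENDs **`o5_index_unit_of_ordinary_companion_cited_s0f_ratlog`** / **`…_cited_s0f_iso_ratlog`** — the ENDs
  of record with `hQW` REPLACED by `(h₀, steps, hrun, hcert)`; every other binder verbatim, same displayed facts.

Worked rows (EVIDENCE that the front-end closes, `HOME/b2b-bsdres-o5-r2/gen26/census/ladder_logcert.py`, exact
rationals): `133020o1` (`⟨0,0,0,−972,8289⟩`, `Q₀ = (−12, 135)`): `6 • Q₀ = (53506441/788544, −353427662555/700227072)`,
`788544 = 2⁶·3²·37²`, level `1 = ord₃ 6` ✓; `25938i1` (`⟨1,−1,1,−10181,302077⟩`, `Q₀ = (−5, 596)`):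
`6 • Q₀ = (103192633/968256, 565547791711/952763904)`, `968256 = 2⁶·3²·41²` ✓ — the two rows whose `hcong`
is already kernel-certified (part 20b, p356989); both census `dE = 0`. Row instances are NOT in this file:
part 24b (`O5/HeegnerLogTransportThreeLogUnitCertRows.lean`, THEOREMS over part 20b's curve literals) decides
both rows' `hQW` (and their global minimality) in the kernel. BATCH TIE (EVIDENCE, `gen26/census/kl3_logcert_batch.py`
→ `KL3-logcert-batch-o5r2-g26.tsv`): on ALL 870 KL3 pairs (363 distinct `W`, every one III* at 3, `m₀ = 6`)
the certificate's prediction `k − ord₃ m` (first `m ∈ {3, 6}` with `x(m•Q₀) ∉ ℤ₃`) EQUALS the census `dE`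
(870/870), and `logUnitOKQ` holds on exactly the 753 `dE = 0` pairs (310 distinct `W`).

HONEST FRAMING, again: the END conclusion and every displayed published fact (Kriz–Li 1.16, Poitou–Tate, local
Euler–Poincaré, Yan–Zhu 4.15, Wuthrich Lemma 20, modularity, GZK, Kolyvagin) are unchanged; `hQW` moves from
the INSTRUMENT column `dE` to a kernel-checked certificate, nothing else. O5 OPEN; nothing booked.

References: [SilvermanAEC2009] III.2.3 (group law), IV.6.3(a), IV.6.4, VII.2.2 (`3v(x) = 2v(y)` on `E₁`),
VII.3.1; [Castella2018] §2.2, Thm. 2.3 (arXiv:1704.06608 p. 5: `log_{ω_E}`); [KrizLi2019] Thm. 1.16, Rem. 1.17;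
[KrausOesterle1992] Prop. 3; cell files `Additive/PadicLogFormalGroup.lean`, `Additive/PadicLogImage.lean`,
`X11b/BDPRouteLocalIndex.lean` (§1 pattern), `Supersingular/RationalLadder.lean` (ladder),
`O5/HeegnerLogTransportThreeRatLogUnit.lean` (part 12), `O5/HeegnerLogTransportThreeStepZeroEndAnyDiscr{,Iso}.lean` (ENDs).

## TYPER PLACEMENT NOTE

Imports TREE files only. Namespace `Summit.BirchSwinnertonDyer.Rank1Residual.O5.HeegnerLogTransport`; one `def`
(`logUnitOKQ : ℕ → ℕ → ℕ → ℚ → Bool`, a checker, no mathematical object) ⇒ propose as kind definition (async-audit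
lane, as part 20b) or split §5–§6 off if the gate prefers; `lean check` rc 0, 0 sorries, 0 warnings; axioms
`propext`, `Classical.choice`, `Quot.sound` (o5-r2 GEN 26). Target path `O5/HeegnerLogTransportThreeLogUnitCert.lean`.

### cc-typer-5 GEN 20 (O5 §3.5 / O6 §3.4 typer of record) — by-name ask A-O5-G26-1 of o5-r2 GEN 26, HOME/INBOX.md l.14784: '(c) PART 24 c9ccd78a3c12acdd → NEW leaf
`O5/HeegnerLogTransportThreeLogUnitCert.lean` … THEN (d) PART 24b 45004bfa402f8b0d → NEW leaf `O5/HeegnerLogTransportThreeLogUnitCertRows.lean` (by sha, byte-identical + your ¶,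
or not at all)'; memo `HOME/b2b-bsdres-o5-r2/gen26/O5-GEN26.md` ec0f62f29e09e06b; order of record (after this seat's parts 20 / 20b / 21 / (a) / 23): core → cert → rows.

Source: `HOME/b2b-bsdres-o5-r2/gen26/lean/HeegnerLogTransportThreeLogUnitCert.lean` sha16 `c9ccd78a3c12acdd` (516 l.; `gen26/SHA16.txt`; o5-r2's checks: farm rc 0 / 0 warn /
0 sorry, `#print axioms` of both ENDs + `logUnitOKQ_sound` standard, dedup of 18 names none; joint scratch with part 24b `gen26/lean/scratch/concat_cert_rows.lean`
e90cc623846ed20a rc 0), re-hashed by the typer right before writing.  ONE TYPER DEDUP EDIT (gate-forced; the byte-identical CORE dry-ran BOUNCED `dedup.landed`): §0's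
second helper `padicNorm_le_inv_of_norm_lt_one` (`‖t‖ < 1 ⇒ ‖t‖ ≤ p⁻¹` in `ℚ_p`) restated the already-landed, importable `Literature.NumberTheory.EllipticCurves.norm_le_inv_of_norm_lt_one`
(`Literature/NumberTheory/EllipticCurves/PAdicHeightsLogProofs.lean` l.88, in the import closure) ⇒ its 4 lines (source l.124–127) became a 4-line comment (line-neutral) and its ONE
call site (l.230, proof of `norm_padicLog_eq_norm_formalParameter`) uses the landed lemma; nothing else differs (corrected source sha16 b133124a52db197f, `class-closure/typer-5/gen20/dedupfix.diff`;
17 of the 18 declarations and every statement byte-identical; flagged to o5-r2 on the bus).  SPLIT (typer; the source's 516 lines exceed the gate's 400-line `lint.size` for NEW files under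
`Rank1Residual/O5/` — cf. KL3 part 18, cc-typer-5 GEN 19 — and the source's own placement note above allows 'split §5–§6 off'): PART 24 = TWO files, every declaration
block byte-identical and in source order, ONE namespace `…O5.HeegnerLogTransport` (every FQN is the source's); script `class-closure/typer-5/gen20/g26_place.py`, anchors asserted:
  CORE = `O5/HeegnerLogTransportThreeLogUnitCertCore.lean` = source l.1–81 (imports + module text UNCHANGED — so its §5 / §6 bullets describe the sibling CERT file) + this ¶ +
         l.82–335 (§0 helpers, §1 `‖log_W t‖ = ‖t‖` on `pℤ_p` for odd `p`, §2 `padicLog = log_W ∘ z` on `E₁`, §3 KERNEL `dE` READOUT `valuation_padicLog_of_nsmul_eq`,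
         §4 `exists_logUnit_point_of_nsmul_eq`) + the closing `end`s (l.513–516); THEOREMS ONLY (12 incl. one `private`, after the dedup edit), kind proof;
  CERT = `O5/HeegnerLogTransportThreeLogUnitCert.lean` (the ASKED module name, so part 24b's `import …LogUnitCert` resolves byte-identically) = `import …LogUnitCertCore` + a header
         assembled from source l.14–22 / l.47–53 / l.55–64 / l.66–74 / l.76–81 VERBATIM + this ¶ + source l.84–104 (options, `open`s, namespace) + l.337–516 VERBATIM (§5 the ONE
         `Bool` checker `def logUnitOKQ` + `logUnitOKQ_sound` + `exists_logUnit_point_of_ladder`, §6 ENDs `o5_index_unit_of_ordinary_companion_cited_s0f_ratlog` /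
         `…_cited_s0f_iso_ratlog`, closing `end`s); kind definition ⇒ the gate's review / async-audit lane (as part 20b p356989).
  THIS file = CORE.
Checks by the typer before each proposal: DEDUP `lean search --decl` on all 17 + 6 new names (none; the gate's statement-level `dedup.landed` caught the 18th, see above); standalone farm `lean check` on TREE imports (rc 0 / 0 warnings / 0 sorries;
CERT after CORE's olean, ROWS after CERT's — concat scratches meanwhile), `#print axioms` of `exists_logUnit_point_of_nsmul_eq` / `…_cited_s0f_iso_ratlog` /
`KL3X3EInstances.exists_logUnit_point_W25938i1'` standard, dry-run clean; imports in the tree: E117 `…StepZeroEndAnyDiscrIso` p357191 (harvest-2), part 12 `…RatLogUnit` p351404,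
`Additive.PadicLogFormalGroup`, `Supersingular.RationalLadder`, part 20b `…IsoCurrencyRows` p356989, `X11b.KrausMinimalityGeneralTwo`.
CONTENT LABELS (source, unchanged): theorems + ONE `Bool` checker `def` (CERT file), 0 `@[conjecture]`, 0 Literature facts (net named-fact debt 0), no `sorry`; published inputs
stay displayed hypotheses BY NAME (A314 Kriz–Li 1.16, Poitou–Tate, local EP, Yan–Zhu 4.15, Wuthrich L20, modularity, GZK — exactly `_cited_s0f`'s); `hQW` moves from the
INSTRUMENT column `dE` (PARI `elllog`) to a kernel-checked certificate, nothing else; the batch tie 870 / 870 and the worked rows are EVIDENCE. HONEST FRAMING (cell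
`b2b-bsdres`): research route, lane CLASS-CLOSURE §3.5 O5; CONDITIONAL ENDs — nothing asserted beyond the displayed binders, nothing booked, no mark / label / count / tier
of `RESIDUAL-MAP.md` moves; census = EVIDENCE, never a Literature fact; O5 OPEN.
-/

set_option autoImplicit false

noncomputable section

open scoped Classical

open WeierstrassCurve Literature.NumberTheory.EllipticCurves
  Literature.NumberTheory.EllipticCurves.ModularForms
  Literature.NumberTheory.EllipticCurves.Rank1Residual
  Literature.NumberTheory.EllipticCurves.Rank1Residual.Typed
open Summit.BirchSwinnertonDyer.Rank1Residual.X1.CongruenceTransfer (TorsionIso)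
open Summit.BirchSwinnertonDyer.Rank1Residual.X11b (embAt padicPointOf)
open Summit.BirchSwinnertonDyer.Rank1Residual.Additive.LocalLog
  (padicLog padicLog_eq_zero_iff padicLog_eq_padicLogPoint_nsmul_div padicLogPoint_nsmul
    index_formalFiltration_two_ne_zero)
open IsDedekindDomain (HeightOneSpectrum)
open Literature.NumberTheory.GaloisCohomology (poitouTate_selmerStructure_duality)
open Literature.NumberTheory.GaloisRepresentations (localEulerPoincareCharacteristic)
open scoped NumberField

namespace Summit.BirchSwinnertonDyer.Rank1Residual.O5.HeegnerLogTransport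

/-! ## §0 Two valuation helpers on `ℚ_p` -/

section Helpers

variable {p : ℕ} [Fact p.Prime]

/-- Equal norms ⇒ equal valuations in `ℚ_p` (including the junk value `0` at `0`). [folklore] -/
theorem padicValuation_eq_of_norm_eq {a b : ℚ_[p]} (h : ‖a‖ = ‖b‖) : a.valuation = b.valuation := by
  by_cases ha : a = 0
  · have hb : b = 0 := by rwa [ha, norm_zero, eq_comm, norm_eq_zero] at h
    rw [ha, hb]
  · have hb : b ≠ 0 := by
      intro hb; rw [hb, norm_zero, norm_eq_zero] at h; exact ha h
    rw [Padic.norm_eq_zpow_neg_valuation ha, Padic.norm_eq_zpow_neg_valuation hb] at h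
    have hp1 : (1 : ℝ) < p := by exact_mod_cast (Fact.out : p.Prime).one_lt
    have := zpow_right_injective₀ (by positivity) hp1.ne' h
    linarith

-- TYPER DEDUP NOTE (cc-typer-5 GEN 20; gate `dedup.landed` on the byte-identical file): o5-r2's second §0 helper
-- `padicNorm_le_inv_of_norm_lt_one {t : ℚ_[p]} (ht : ‖t‖ < 1) : ‖t‖ ≤ (p : ℝ)⁻¹` restated the landed, importable
-- `Literature.NumberTheory.EllipticCurves.norm_le_inv_of_norm_lt_one` (`PAdicHeightsLogProofs.lean`, in this file's import
-- closure); the copy is deleted and §2 `norm_padicLog_eq_norm_formalParameter` cites the landed lemma instead.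

end Helpers

/-! ## §1 `‖log_W(t)‖ = ‖t‖` on `pℤ_p` for odd `p` -/

section FormalLog

open PowerSeries

variable {p : ℕ} [Fact p.Prime]

/-- `(n + 2) rⁿ ≤ 2` for `0 ≤ r ≤ 1/2`. [folklore] -/
private theorem aux_bound_half {r : ℝ} (hr0 : 0 ≤ r) (hr : r ≤ 1 / 2) (n : ℕ) :
    ((n : ℝ) + 2) * r ^ n ≤ 2 := by
  induction n with
  | zero => simp
  | succ n ih =>
    have h1 : ((n : ℝ) + 1 + 2) * r ^ (n + 1) = (((n : ℝ) + 3) * r) * r ^ n := by ring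
    rw [Nat.cast_succ, h1]
    have hn : (0 : ℝ) ≤ n := n.cast_nonneg
    have h2 : ((n : ℝ) + 3) * r ≤ (n : ℝ) + 2 := by nlinarith
    calc ((n : ℝ) + 3) * r * r ^ n ≤ ((n : ℝ) + 2) * r ^ n :=
          mul_le_mul_of_nonneg_right h2 (pow_nonneg hr0 n)
      _ ≤ 2 := ih

variable (X : WeierstrassCurve ℚ_[p]) [hX : X.IsIntegral ℤ_[p]]

/-- **`‖log_W(t) − t‖_p ≤ 2‖t‖²` for `‖t‖ ≤ 1/2`** (`p`-integral `W`): `log_W(t) = t + Σ_{n≥2} cₙtⁿ` with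
`‖cₙ‖ ≤ n` (AEC IV.6.3(a), tree `norm_coeff_formalLog_le`) and `n rⁿ ≤ 2r²` for `r ≤ 1/2` — the tree's
`Additive.LocalLog.norm_padicFormalLog_sub_self_le` with its hypothesis `‖t‖ ≤ p⁻²` relaxed to `‖t‖ ≤ 1/2`.
[cite: SilvermanAEC2009, IV.6.3(a) and IV.6.4] -/
theorem norm_padicFormalLog_sub_self_le_of_norm_le_half {t : ℚ_[p]} (ht : ‖t‖ ≤ 1 / 2) :
    ‖X.padicFormalLog t - t‖ ≤ 2 * ‖t‖ ^ 2 := by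
  set r := ‖t‖ with hr
  have hr0 : 0 ≤ r := norm_nonneg t
  have hr1 : r < 1 := by linarith
  have hsum : Summable fun n : ℕ => coeff n X.formalLog * t ^ n :=
    X.summable_formalLog_of_isIntegral t hr1
  have hsplit : X.padicFormalLog t = t + ∑' n : ℕ, coeff (n + 2) X.formalLog * t ^ (n + 2) := by
    rw [WeierstrassCurve.padicFormalLog, hsum.tsum_eq_zero_add,
      (summable_nat_add_iff 1 |>.mpr hsum).tsum_eq_zero_add]
    simp only [zero_add, pow_zero, mul_one, pow_one, WeierstrassCurve.coeff_one_formalLog, one_mul]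
    rw [show coeff 0 X.formalLog = 0 from by
      rw [PowerSeries.coeff_zero_eq_constantCoeff_apply]; exact X.constantCoeff_formalLog]
    ring_nf
  rw [hsplit, add_sub_cancel_left]
  refine IsUltrametricDist.norm_tsum_le_of_forall_le_of_nonneg (by positivity) fun n => ?_
  rw [norm_mul, norm_pow]
  calc ‖coeff (n + 2) X.formalLog‖ * r ^ (n + 2) ≤ ((n + 2 : ℕ) : ℝ) * r ^ (n + 2) :=
        mul_le_mul_of_nonneg_right (X.norm_coeff_formalLog_le (n + 2)) (pow_nonneg hr0 _)
    _ = (((n : ℝ) + 2) * r ^ n) * r ^ 2 := by push_cast; ring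
    _ ≤ 2 * r ^ 2 := mul_le_mul_of_nonneg_right (aux_bound_half hr0 ht n) (pow_nonneg hr0 2)

/-- **`‖log_W(t)‖_p = ‖t‖_p` for `‖t‖ < 1/2`** (`p`-integral `W`): `‖log_W(t) − t‖ ≤ 2‖t‖² < ‖t‖` and the
ultrametric inequality. [cite: SilvermanAEC2009, IV.6.4(b)] -/
theorem norm_padicFormalLog_eq_of_norm_lt_half {t : ℚ_[p]} (ht : ‖t‖ < 1 / 2) :
    ‖X.padicFormalLog t‖ = ‖t‖ := by
  rcases eq_or_ne t 0 with rfl | ht0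
  · rw [X.padicFormalLog_zero]
  · have h := norm_padicFormalLog_sub_self_le_of_norm_le_half X ht.le
    have hpos : 0 < ‖t‖ := norm_pos_iff.mpr ht0
    have hlt : ‖X.padicFormalLog t - t‖ < ‖t‖ := by
      refine h.trans_lt ?_
      nlinarith
    calc ‖X.padicFormalLog t‖ = ‖(X.padicFormalLog t - t) + t‖ := by rw [sub_add_cancel]
      _ = max ‖X.padicFormalLog t - t‖ ‖t‖ :=
          IsUltrametricDist.norm_add_eq_max_of_norm_ne_norm (ne_of_lt hlt)
      _ = ‖t‖ := max_eq_right hlt.le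

/-- **`‖log_W(t)‖_p = ‖t‖_p` on all of `pℤ_p` (`‖t‖ ≤ p⁻¹`) when `p` is ODD** (`p⁻¹ ≤ 1/3 < 1/2`). At `p = 2`
the hypothesis `‖t‖ ≤ 1/2` does NOT suffice (`‖c₂t²‖` may equal `‖t‖`); the tree's `norm_padicFormalLog_eq`
(`‖t‖ ≤ p⁻²`) covers that case. [cite: SilvermanAEC2009, IV.6.4(b)] -/
theorem norm_padicFormalLog_eq_of_norm_le_inv (hp : p ≠ 2) {t : ℚ_[p]} (ht : ‖t‖ ≤ (p : ℝ)⁻¹) :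
    ‖X.padicFormalLog t‖ = ‖t‖ := by
  have h3 : 3 ≤ p := Nat.succ_le_of_lt ((Fact.out : p.Prime).two_le.lt_of_ne (Ne.symm hp))
  have hp3 : (3 : ℝ) ≤ p := by exact_mod_cast h3
  refine norm_padicFormalLog_eq_of_norm_lt_half X (ht.trans_lt ?_)
  calc (p : ℝ)⁻¹ ≤ (3 : ℝ)⁻¹ := inv_anti₀ (by norm_num) hp3
    _ < 1 / 2 := by norm_num

end FormalLog

/-! ## §2 `padicLog = log_W ∘ z` on `E₁(ℚ_p)`; its norm and valuation there (odd `p`) -/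

section Local

variable {p : ℕ} [Fact p.Prime] (X : WeierstrassCurve ℚ_[p]) [hX : X.IsIntegral ℤ_[p]] [X.IsElliptic]

/-- **`padicLog X P = log_W(z(P))` for every `P ∈ E₁(ℚ_p)`** (the tree's `padicLog_eq_padicLogPoint_of_mem` is the
case `P ∈ E⁽²⁾`): `padicLog X P = log_W z(N • P)/N` and `log_W z(N • P) = N · log_W z(P)` on `E₁` (additivity,
`Additive.LocalLog.padicLogPoint_nsmul`). [cite: SilvermanAEC2009, IV.6.4 and VII.2.2] -/
theorem padicLog_eq_padicLogPoint_of_isInReductionKernel {P : X.toAffine.Point}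
    (hP : X.IsInReductionKernel P) : padicLog X P = X.padicLogPoint P := by
  rw [padicLog_eq_padicLogPoint_nsmul_div X P, padicLogPoint_nsmul X hP,
    mul_div_cancel_left₀ _ (Nat.cast_ne_zero.mpr (index_formalFiltration_two_ne_zero X))]

/-- **`‖padicLog X P‖ = ‖z(P)‖` on `E₁(ℚ_p)` for odd `p`** (`‖z(P)‖ < 1`, hence `≤ p⁻¹`, and §1).
[cite: SilvermanAEC2009, IV.6.4(b) and VII.2.2] -/
theorem norm_padicLog_eq_norm_formalParameter (hp : p ≠ 2) {P : X.toAffine.Point}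
    (hP : X.IsInReductionKernel P) : ‖padicLog X P‖ = ‖X.formalParameter P‖ := by
  rw [padicLog_eq_padicLogPoint_of_isInReductionKernel X hP, WeierstrassCurve.padicLogPoint]
  exact norm_padicFormalLog_eq_of_norm_le_inv X hp
    (norm_le_inv_of_norm_lt_one (X.norm_formalParameter_lt_one hP))

/-- `ord_p (padicLog X P) = ord_p z(P)` on `E₁(ℚ_p)` for odd `p`. [cite: SilvermanAEC2009, IV.6.4(b) and VII.2.2] -/
theorem valuation_padicLog_eq_valuation_formalParameter (hp : p ≠ 2) {P : X.toAffine.Point}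
    (hP : X.IsInReductionKernel P) :
    (padicLog X P).valuation = (X.formalParameter P).valuation :=
  padicValuation_eq_of_norm_eq (norm_padicLog_eq_norm_formalParameter X hp hP)

/-! ## §3 KERNEL `dE` READOUT: `ord_p log_ω(Q) = k − ord_p m` from `m • Q = (x_R, y_R)`, `ord_p x_R = −2k` -/

omit [X.IsElliptic] in
/-- **The level of a point of `E₁(ℚ_p)` from its abscissa**: for `R = (x_R, y_R)` on a `p`-integral equation
with `ord_p x_R = −2k < 0`: `R ∈ E₁(ℚ_p)` and `ord_p z(R) = k` (`‖y_R‖² = ‖x_R‖³`, tree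
`norm_sq_eq_norm_cube`, i.e. `3 ord x = 2 ord y`, AEC VII.2.2). [cite: SilvermanAEC2009, VII.2.2] -/
theorem valuation_formalParameter_some_of_valuation_x {xR yR : ℚ_[p]} (hR : X.toAffine.Nonsingular xR yR)
    {k : ℕ} (hk : 0 < k) (hx : xR.valuation = -(2 * (k : ℤ))) :
    X.IsInReductionKernel (.some xR yR hR) ∧ X.formalParameter (.some xR yR hR) ≠ 0 ∧
      (X.formalParameter (.some xR yR hR)).valuation = k := by
  have hp1 : (1 : ℝ) < p := by exact_mod_cast (Fact.out : p.Prime).one_lt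
  have hxR0 : xR ≠ 0 := by
    intro h; rw [h, Padic.valuation_zero] at hx; omega
  have hxn : 1 < ‖xR‖ := by
    rw [Padic.norm_eq_zpow_neg_valuation hxR0, hx, neg_neg]
    exact one_lt_zpow₀ hp1 (by omega)
  have hRk : X.IsInReductionKernel (.some xR yR hR) := (X.isInReductionKernel_some hR).mpr hxn
  obtain ⟨hyR0, hz0, -, -, -⟩ := X.param_facts hR.left hxn
  obtain ⟨hsq, -⟩ := X.norm_sq_eq_norm_cube hR.left hxn
  have hvy : 2 * yR.valuation = 3 * xR.valuation := by
    have h1 : ‖yR ^ 2‖ = ‖xR ^ 3‖ := by rw [norm_pow, norm_pow, hsq]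
    have h2 := padicValuation_eq_of_norm_eq h1
    rw [Padic.valuation_pow, Padic.valuation_pow] at h2
    push_cast at h2
    linarith
  have hneg : (-xR).valuation = xR.valuation := padicValuation_eq_of_norm_eq (norm_neg xR)
  refine ⟨hRk, by rw [X.formalParameter_some hR]; exact hz0, ?_⟩
  rw [X.formalParameter_some hR, div_eq_mul_inv,
    Padic.valuation_mul (neg_ne_zero.mpr hxR0) (inv_ne_zero hyR0), Padic.valuation_inv, hneg]
  omega

/-- **KERNEL `dE` READOUT.** `X/ℚ_p` a `p`-integral elliptic equation, `p` ODD; `m • Q = R = (x_R, y_R)` with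
`ord_p x_R = −2k`, `k ≥ 1`. Then `padicLog X Q ≠ 0` and `ord_p (padicLog X Q) = k − ord_p m`:
`R ∈ E₁(ℚ_p)` with `ord_p z(R) = k`; `ord_p padicLog R = ord_p z(R)` (§2); `padicLog R = m · padicLog Q`.
With `m = m₀ = [E(ℚ_p) : E₁(ℚ_p)]` this is x11b's `padicLogOrd` and the census column `dE` (= `k − ord_p m₀`).
[cite: SilvermanAEC2009, IV.6.4 and VII.2.2] [cite: Castella2018, §2.2 and Thm. 2.3 (arXiv:1704.06608 p. 5)] -/
theorem valuation_padicLog_of_nsmul_eq (hp : p ≠ 2) {Q : X.toAffine.Point} {xR yR : ℚ_[p]}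
    {hR : X.toAffine.Nonsingular xR yR} {m k : ℕ} (hm : m • Q = .some xR yR hR) (hk : 0 < k)
    (hx : xR.valuation = -(2 * (k : ℤ))) :
    padicLog X Q ≠ 0 ∧ (padicLog X Q).valuation = (k : ℤ) - padicValNat p m := by
  obtain ⟨hRk, hz0, hvz⟩ := valuation_formalParameter_some_of_valuation_x X hR hk hx
  have hLR : ‖padicLog X (.some xR yR hR)‖ = ‖X.formalParameter (.some xR yR hR)‖ :=
    norm_padicLog_eq_norm_formalParameter X hp hRk
  have hLR0 : padicLog X (.some xR yR hR) ≠ 0 := by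
    intro h; rw [h, norm_zero, eq_comm, norm_eq_zero] at hLR; exact hz0 hLR
  have hmul : padicLog X (.some xR yR hR) = (m : ℚ_[p]) * padicLog X Q := by
    rw [← hm, map_nsmul, nsmul_eq_mul]
  have hm0 : (m : ℚ_[p]) ≠ 0 := by
    intro h0; rw [h0, zero_mul] at hmul; exact hLR0 hmul
  have hLQ0 : padicLog X Q ≠ 0 := by
    intro h0; rw [h0, mul_zero] at hmul; exact hLR0 hmul
  refine ⟨hLQ0, ?_⟩
  have hval : (padicLog X (.some xR yR hR)).valuation = (X.formalParameter (.some xR yR hR)).valuation :=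
    padicValuation_eq_of_norm_eq hLR
  rw [hmul, Padic.valuation_mul hm0 hLQ0, Padic.valuation_natCast, hvz] at hval
  omega

/-- **Unit case**: `m • Q = (x_R, y_R)`, `ord_p x_R = −2k`, `0 < k = ord_p m` ⇒ `Q` has infinite order and
`ord_p (padicLog X Q) = 0`. [cite: SilvermanAEC2009, IV.6.4 and VII.2.2] -/
theorem valuation_padicLog_eq_zero_of_nsmul_eq (hp : p ≠ 2) {Q : X.toAffine.Point} {xR yR : ℚ_[p]}
    {hR : X.toAffine.Nonsingular xR yR} {m k : ℕ} (hm : m • Q = .some xR yR hR) (hk : 0 < k)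
    (hx : xR.valuation = -(2 * (k : ℤ))) (hmk : padicValNat p m = k) :
    ¬ IsOfFinAddOrder Q ∧ (padicLog X Q).valuation = 0 := by
  obtain ⟨h0, hv⟩ := valuation_padicLog_of_nsmul_eq X hp hm hk hx
  exact ⟨fun hfin => h0 ((padicLog_eq_zero_iff X Q).mpr hfin), by rw [hv, hmk]; simp⟩

end Local

/-! ## §4 Rational certificates ⇒ the END binder `hQW` -/

section Rational

variable (W : WeierstrassCurve ℚ) [W.IsElliptic] [W.IsGloballyMinimal] (p : ℕ) [Fact p.Prime]
  {K : Type} [Field K] [NumberField K]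

/-- **`hQW` from a rational multiple.** `W/ℚ` globally minimal, `p` odd, `Q₀ ∈ W(ℚ)`, `m • Q₀ = (x_R, y_R) ∈ W(ℚ)`
with `padicValRat p x_R = −2k`, `0 < k = padicValNat p m`. Then `Q₀` has infinite order,
`ord_p (padicLog (W ⊗ ℚ_p) (Q₀ ⊗ ℚ_p)) = 0` (§3 read over `ℚ_p`), hence (part 12 `exists_logUnit_point_of_rat`) for every
number field `K` and embedding `ι : K →+* ℚ_p` the END binder: a point of `W(K)` of infinite order with
`padicLogOrd W p ι Q = 0`. [cite: Castella2018, §2.2 and Thm. 2.3 (arXiv:1704.06608 p. 5)]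
[cite: SilvermanAEC2009, IV.6.4, VII.2.2 and VII.3.1] -/
theorem exists_logUnit_point_of_nsmul_eq (hp : p ≠ 2) (ι : K →+* ℚ_[p]) (Q₀ : W.toAffine.Point)
    {xR yR : ℚ} {hR : W.toAffine.Nonsingular xR yR} {m k : ℕ}
    (hm : m • Q₀ = .some xR yR hR) (hk : 0 < k) (hx : padicValRat p xR = -(2 * (k : ℤ)))
    (hmk : padicValNat p m = k) :
    ∃ Q : (W.baseChange K).toAffine.Point, ¬ IsOfFinAddOrder Q ∧ X11b.padicLogOrd W p ι Q = 0 := by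
  have hm' : m • Affine.Point.map (W' := W.toAffine) (S := ℚ) (Algebra.ofId ℚ ℚ_[p]) Q₀ =
      Affine.Point.map (W' := W.toAffine) (S := ℚ) (Algebra.ofId ℚ ℚ_[p]) (.some xR yR hR) := by
    rw [← map_nsmul]; exact congrArg _ hm
  rw [Affine.Point.map_some] at hm'
  have hx' : ((Algebra.ofId ℚ ℚ_[p]) xR).valuation = -(2 * (k : ℤ)) := by
    rw [show (Algebra.ofId ℚ ℚ_[p]) xR = (xR : ℚ_[p]) from eq_ratCast _ xR, Padic.valuation_ratCast, hx]
  obtain ⟨hnt, hval⟩ :=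
    valuation_padicLog_eq_zero_of_nsmul_eq (W.baseChange ℚ_[p]) hp hm' hk hx' hmk
  have hQ₀ : ¬ IsOfFinAddOrder Q₀ := fun h => hnt (AddMonoidHom.isOfFinAddOrder _ h)
  exact exists_logUnit_point_of_rat W p ι Q₀ hQ₀ hval

end Rational


end Summit.BirchSwinnertonDyer.Rank1Residual.O5.HeegnerLogTransport

end
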